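import Literature.NumberTheory.EllipticCurves.ModPIrreducibleNotEisenstein
import Literature.NumberTheory.EllipticCurves.ModPReducibilityProofs
import Literature.RepresentationTheory.FiniteGroups.InvariantLineOfFixedVectorsNormal
import Literature.NumberTheory.EllipticCurves.LFunctionSmulProofs
import Literature.NumberTheory.EllipticCurves.MatarNekovar2019.IrreducibleOverQuadraticFieldProofs
import Literature.NumberTheory.Automorphic.BCDTTheoremBWildAtThreeDet
import HarnessLib

/-!
# `E[p]` irreducible, `p` odd ⟹ `ℓ ↦ a_ℓ(E) mod p` is not Eisenstein — proof

Topic `NumberTheory/EllipticCurves`; `Proofs` companion (theorems only: no definition, no named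
fact, no instance) of `ModPIrreducibleNotEisenstein`, whose ONE named fact
`Literature.NumberTheory.EllipticCurves.not_isEisensteinEigensystem_of_hasIrreducibleModPGaloisRep`
(Darmon–Diamond–Taylor, *Fermat's Last Theorem*, CDM 1995: Prop. 2.6 (b) p. 53, Prop. 2.8 (a)
p. 56, Prop. 2.11 (a) p. 57, §3.1 p. 87 L20–21, Lemma 4.12 p. 120 — statements as printed and the
four-line reading in that file's module docstring) is DISCHARGED here
(`not_isEisensteinEigensystem_of_hasIrreducibleModPGaloisRep_holds`): for every Weierstrass model
`W` of an elliptic curve over `ℚ`, every odd prime `p` with `E[p]` irreducible and every field `F`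
of characteristic `p`, `ℓ ↦ a_ℓ(E) · 1_F` is not `ψ(ℓ) + ℓ φ(ℓ)` off a finite set of primes
(`ψ, φ` Dirichlet characters of any modulus `m ≥ 1` with values in `F`).

## The proof (the printed reading; Chebotarev and Brauer–Nesbitt replaced by tree theorems)

The proof of Lemma 4.12 ("if `𝔪̃` is Eisenstein then proposition 2.6 implies that `ρ_𝔪` restricted
to `G_{ℚ(ζ_{Nℓ})}` has trivial semisimplification from which it follows that `ρ_𝔪` is also
reducible", with p. 87 "if `ℓ` is odd … irreducible if and only if absolutely irreducible" and
Prop. 2.8 (a) `det = ε`) is followed, its two non-tree inputs — Chebotarev for `ℚ(E[p], ζ_M)`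
(Thm. 2.3) and Brauer–Nesbitt (Prop. 2.6 (b)) — being replaced as in the trivial-character case
(`ModPReducibilityProofs`): (1) **Frobenius' density theorem in division form** (PROVED,
`FramedGaloisRep.infinite_setOf_frobenius_mem_division`) for the permutation Artin representation
of `Γ_ℚ` on `E[p] × (ℤ/M)ˣ`, `M = m p` (`exists_framedArtinRep_geomTorsion_prod_cyclotomic`): each
`τ ∈ ker χ_M` acts on `E[p]` as a power of a Frobenius `Φ` above a good `ℓ ∉ S` with `χ_M(Φ) = 1`,
i.e. `ℓ ≡ 1 (mod m p)` (`Rat.modNCyclotomicCharacter_of_isArithFrobAt`), so `ψ(ℓ) = φ(ℓ) = 1`,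
`ℓ = 1` in `F`, the hypothesis reads `a_ℓ ≡ ℓ + 1 (mod p)` (`LFunction_apply_prime_eq_frobeniusTrace`,
Prop. 2.11 (a)), i.e. `p ∣ #Ẽ(𝔽_ℓ)`, and `Φ`, hence `τ`, fixes a non-zero point of `E[p]`
(reduction of torsion, `exists_frobenius_smul_eq_of_dvd_reductionPointCount_holds`); (2) the
**relative invariant-line lemma** (`Representation.smul_eq_self_of_normal_of_forall_exists_fixed`,
file `RepresentationTheory/FiniteGroups/InvariantLineOfFixedVectorsNormal`): the normal subgroup
`ker χ_M` then acts trivially on the irreducible plane `E[p]`, so the image of `Γ_ℚ` is ABELIAN;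
(3) **oddness**: a complex conjugation `c` (`c² = 1`, `χ̄_p(c) = −1`,
`exists_sq_eq_one_modPCyclotomicCharacterZMod_eq_neg_one`, Serre 1972 §5.2 (iv)) commutes with the
image, `ker(c ∓ 1)` are `Γ_ℚ`-stable and not both `⊥` (`(c − 1)(c + 1) = 0`), so `c = ±1` on
`E[p]` and `χ̄_p(c) = det ρ̄_{E,p}(c) = 1` (Weil pairing,
`MatarNekovar2019.modPCyclotomicCharacter_eq_det_of_basis`), contradicting `−1 ≠ 1` in `𝔽_p`.
Model independence: `hasGlobalMinimalModel_rat_holds`, `LFunction_smul`,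
`hasIrreducibleModPGaloisRep_smul_iff`. A parallel SUMMITS-side tool by the same method is
`Summit.BirchSwinnertonDyer.Rank1Residual.GaloisImage.exists_prime_one_mod_not_dvd_frobeniusTrace_sub`
(`EisensteinPrimeInProgression.lean`, cell `b2b-bsdres`: a non-Eisenstein Frobenius in every
cyclotomic progression); the present file is Literature-side and self-contained.

## References

* H. Darmon, F. Diamond, R. Taylor, *Fermat's Last Theorem*, Current Developments in Mathematics
  1995, International Press: Thm. 2.3, Thm. 2.4 (p. 52), Prop. 2.6 (b) (pp. 53–54), Prop. 2.8 (a)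
  (p. 56), Prop. 2.11 (a) (p. 57), §3.1 p. 87, Lemma 4.12 (p. 120). [DarmonDiamondTaylor1995]
* J.-P. Serre, *Propriétés galoisiennes des points d'ordre fini des courbes elliptiques*, Invent.
  Math. 15 (1972), §1.11, §4, §5.2 (iii)–(iv). [Serre1972]
* D. A. Marcus, *Number Fields*, 2nd ed. (2018), Ch. 7, Exercise 12 (f) (Frobenius Density
  Theorem). [Marcus2018]
* J. H. Silverman, *The Arithmetic of Elliptic Curves*, 2nd ed. (2009), Prop. VII.3.1 (b),
  Cor. III.6.4 (b), VIII.8. [SilvermanAEC2009]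

Design: theorems only, `namespace Literature.NumberTheory.EllipticCurves`; the closing theorem has
EXACTLY the fact's type; axioms of every theorem: `propext`, `Classical.choice`, `Quot.sound`.
-/

noncomputable section

open scoped Classical

namespace Literature.NumberTheory.EllipticCurves

open _root_.NumberField _root_.IsDedekindDomain _root_.Field _root_.WeierstrassCurve

/-! ### The permutation Artin representation on `E[n] × (ℤ/M)ˣ` and Frobenius' theorem -/

/-- **The permutation Artin representation of `Γ_ℚ` on `E[n] × (ℤ/Mℤ)ˣ`** (`n ≠ 0`, `M ≠ 0`;
second factor through the mod-`M` cyclotomic character, `(ℤ/M)ˣ` acting on itself by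
translation): `Γ_ℚ → Perm(E[n] × (ℤ/M)ˣ) ≃ Perm(Fin m) → GL_m(ℂ)`, with open kernel
(`⊇ ⋂_P Stab(P) ∩ ker χ_M`) and faithful on the pair (action on `E[n]`, `χ_M`) — the Artin
representation of `ℚ(E[n], ζ_M)/ℚ` of the proof of Darmon–Diamond–Taylor's Lemma 4.12; same
construction as `exists_framedArtinRep_geomTorsion` (Serre 1972 §4).
[cite: Serre1972, §4; DarmonDiamondTaylor1995, Thm. 2.4 (p. 52) and Lemma 4.12 (p. 120)] -/
theorem exists_framedArtinRep_geomTorsion_prod_cyclotomic (W : WeierstrassCurve ℚ) [W.IsElliptic]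
    {n : ℤ} (hn : n ≠ 0) (M : ℕ) [NeZero M] :
    ∃ (m : ℕ) (ρ : GaloisRepresentations.FramedArtinRep ℚ m),
      IsOpen (ρ.toMonoidHom.ker : Set (absoluteGaloisGroup ℚ)) ∧
        ∀ x y : absoluteGaloisGroup ℚ, ρ x = ρ y →
          (∀ P : W.geomTorsion n, x • P = y • P) ∧
            GaloisRepresentations.modNCyclotomicCharacter ℚ M x =
              GaloisRepresentations.modNCyclotomicCharacter ℚ M y := by
  classical
  haveI : NeZero (M : ℚ) := NeZero.charZero
  set χ := GaloisRepresentations.modNCyclotomicCharacter ℚ M with hχdef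
  letI instU : MulAction (absoluteGaloisGroup ℚ) (ZMod M)ˣ := MulAction.compHom _ χ
  have hunit : ∀ (σ : absoluteGaloisGroup ℚ) (u : (ZMod M)ˣ), σ • u = χ σ * u := fun _ _ ↦ rfl
  -- the finite `Γ_ℚ`-set `X = E[n] × (ℤ/M)ˣ`
  haveI : Finite (W.geomTorsion n) := finite_torsionPoints_holds W (AlgebraicClosure ℚ) hn
  set X := W.geomTorsion n × (ZMod M)ˣ with hX
  haveI : Finite X := inferInstance
  set m : ℕ := Nat.card X
  let e : X ≃ Fin m := Finite.equivFin X
  -- the permutation representation `Γ_ℚ → Perm X ≃ Perm (Fin m) → Matrix → GL`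
  let a : absoluteGaloisGroup ℚ →* Equiv.Perm X := MulAction.toPermHom _ X
  let π : absoluteGaloisGroup ℚ →* Equiv.Perm (Fin m) := e.permCongrHom.toMonoidHom.comp a
  let Mt : absoluteGaloisGroup ℚ →* Matrix (Fin m) (Fin m) ℂ :=
    (Matrix.permMatrixHom (n := Fin m) (R := ℂ)).comp π
  let ρ₀ : absoluteGaloisGroup ℚ →* GL (Fin m) ℂ := Mt.toHomUnits
  -- its kernel contains the open subgroup `(⋂_{P ∈ E[n]} Stab(P)) ⊓ ker χ_M`
  let K : Subgroup (absoluteGaloisGroup ℚ) :=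
    (⨅ P : W.geomTorsion n, MulAction.stabilizer _ (P : W.geomPoints)) ⊓ χ.ker
  have hχopen : IsOpen (χ.ker : Set (absoluteGaloisGroup ℚ)) := by
    refine Subgroup.isOpen_of_mem_nhds χ.ker (g := 1) ?_
    have hset : (χ.ker : Set (absoluteGaloisGroup ℚ)) = {σ | χ σ = 1} := by
      ext σ; exact MonoidHom.mem_ker
    exact hset ▸ GaloisRepresentations.modNCyclotomicCharacter_eventually_eq_one ℚ M
  have hKopen : IsOpen (K : Set (absoluteGaloisGroup ℚ)) := by
    have : (K : Set (absoluteGaloisGroup ℚ)) =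
        (⋂ P : W.geomTorsion n,
          (MulAction.stabilizer (absoluteGaloisGroup ℚ) (P : W.geomPoints) : Set _)) ∩
          (χ.ker : Set (absoluteGaloisGroup ℚ)) := by
      simp only [K, Subgroup.coe_inf, Subgroup.coe_iInf]
    rw [this]
    exact IsOpen.inter (isOpen_iInter_of_finite fun P : W.geomTorsion n ↦
      isOpen_stabilizer_point_holds W (P : W.geomPoints)) hχopen
  have hKa : ∀ k ∈ K, a k = 1 := by
    intro k hk
    obtain ⟨hk1, hk2⟩ := Subgroup.mem_inf.mp hk
    refine Equiv.ext fun x ↦ ?_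
    obtain ⟨P, u⟩ := x
    change k • (P, u) = (P, u)
    rw [Prod.smul_mk, Prod.mk.injEq]
    refine ⟨?_, ?_⟩
    · have hkP : k ∈ MulAction.stabilizer (absoluteGaloisGroup ℚ) (P : W.geomPoints) :=
        (Subgroup.mem_iInf.mp hk1) P
      exact Subtype.ext (MulAction.mem_stabilizer_iff.mp hkP)
    · rw [hunit, MonoidHom.mem_ker.mp hk2, one_mul]
  have hKρ : ∀ k ∈ K, ρ₀ k = 1 := by
    intro k hk
    ext : 1
    change Matrix.permMatrixHom (e.permCongrHom (a k)) = (1 : Matrix (Fin m) (Fin m) ℂ)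
    rw [hKa k hk, map_one, map_one]
  have hcont : Continuous ρ₀ := continuous_of_isOpen_subgroup_le_ker ρ₀ K hKopen hKρ
  let ρ : GaloisRepresentations.FramedArtinRep ℚ m := ⟨ρ₀, hcont⟩
  refine ⟨m, ρ, ?_, fun x y hρ ↦ ?_⟩
  · exact Subgroup.isOpen_mono (H₁ := K) (fun k hk ↦ MonoidHom.mem_ker.mpr (hKρ k hk)) hKopen
  · -- `ρ x = ρ y` forces `a x = a y`
    have hM : Mt x = Mt y := congr_arg (fun u : GL (Fin m) ℂ ↦ (u : Matrix (Fin m) (Fin m) ℂ)) hρ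
    have hπ : π x = π y := by
      have h1 : Equiv.Perm.permMatrix ℂ (π x)⁻¹ = Equiv.Perm.permMatrix ℂ (π y)⁻¹ := hM
      have h2 : ((π x)⁻¹).toPEquiv = ((π y)⁻¹).toPEquiv := PEquiv.toMatrix_injective h1
      have h3 : (π x)⁻¹ = (π y)⁻¹ := by
        refine Equiv.ext fun i ↦ ?_
        have hi := congr_arg (fun q : Fin m ≃. Fin m ↦ q i) h2
        simpa [Equiv.toPEquiv_apply] using hi
      exact inv_injective h3
    have ha : a x = a y := e.permCongrHom.injective hπ
    refine ⟨fun P ↦ congr_arg Prod.fst (Equiv.congr_fun ha (P, 1)), ?_⟩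
    · have := congr_arg Prod.snd (Equiv.congr_fun ha ((0 : W.geomTorsion n), 1))
      change x • (1 : (ZMod M)ˣ) = y • (1 : (ZMod M)ˣ) at this
      rwa [hunit, hunit, mul_one, mul_one] at this

/-- **Frobenius' theorem for `ℚ(E[n], ζ_M)/ℚ` on `ker χ_M`**: every `τ ∈ Γ_ℚ` with `χ_M(τ) = 1`
acts on `E[n]` as a power `Φ^j` of an arithmetic Frobenius `Φ` above a prime `ℓ` outside any
finite set, with `χ_M(Φ) = 1` (Frobenius' density theorem in division form,
`FramedGaloisRep.infinite_setOf_frobenius_mem_division`, on `E[n] × (ℤ/M)ˣ`: `ρ(Φ) = ρ(τ)^k`,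
`(k, ord ρ(τ)) = 1`, so `χ_M(Φ) = χ_M(τ)^k = 1` and `ρ(τ) = ρ(Φ)^j`; Chebotarev would give `j = 1`).
[cite: Marcus2018, Ch. 7, Exercise 12 (f) (Frobenius Density Theorem)] -/
theorem exists_frobenius_pow_smul_eq_of_cyclotomic_eq_one (W : WeierstrassCurve ℚ) [W.IsElliptic]
    {n : ℤ} (hn : n ≠ 0) (M : ℕ) [NeZero M] (S : Set ℕ) (hS : S.Finite)
    (τ : absoluteGaloisGroup ℚ) (hτ : GaloisRepresentations.modNCyclotomicCharacter ℚ M τ = 1) :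
    ∃ (ℓ : ℕ) (v : HeightOneSpectrum (𝓞 ℚ))
      (𝔓 : Ideal (GaloisRepresentations.absIntegers (𝓞 ℚ) ℚ)) (φ : absoluteGaloisGroup ℚ),
      ℓ.Prime ∧ ℓ ∉ S ∧ (ℓ : 𝓞 ℚ) ∈ v.asIdeal ∧ 𝔓 ∈ v.primesAbove ∧ IsArithFrobAt (𝓞 ℚ) φ 𝔓 ∧
        GaloisRepresentations.modNCyclotomicCharacter ℚ M φ = 1 ∧
        ∃ j : ℕ, ∀ P : W.geomTorsion n, τ • P = (φ ^ j) • P := by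
  obtain ⟨m, ρ, hker, hfaith⟩ := exists_framedArtinRep_geomTorsion_prod_cyclotomic W hn M
  obtain ⟨v, ⟨-, 𝔓, h𝔓, φ, hφ, k, hk, hρ⟩, hvB⟩ :=
    (GaloisRepresentations.FramedGaloisRep.infinite_setOf_frobenius_mem_division ρ hker
      τ).exists_notMem_finite (finite_setOf_place_over S hS)
  obtain ⟨ℓ, hℓ, hℓv⟩ := exists_prime_natCast_mem v
  have hℓS : ℓ ∉ S := fun hmem ↦ hvB (Set.mem_biUnion (x := ℓ) ⟨hmem, hℓ.ne_zero⟩ hℓv)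
  obtain ⟨j, hj⟩ := exists_pow_eq_self_of_coprime hk
  have h1 := hfaith φ (τ ^ k) (by rw [map_pow, hρ])
  have h2 := hfaith τ (φ ^ j) (by rw [map_pow, hρ, hj])
  refine ⟨ℓ, v, 𝔓, φ, hℓ, hℓS, hℓv, h𝔓, hφ, ?_, j, h2.1⟩
  rw [h1.2, map_pow, hτ, one_pow]

/-! ### Step 1: every element of `Γ_{ℚ(ζ_{mp})}` fixes a non-zero point of `E[p]` -/

/-- **Step 1 of the reading of Lemma 4.12** (global minimal model). If `a_ℓ(E) = ψ(ℓ) + ℓ φ(ℓ)`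
in a field `F` of characteristic `p` for all primes `ℓ ∉ S` (`ψ, φ` Dirichlet characters mod `m`),
then every `τ ∈ Γ_ℚ` with `χ_{mp}(τ) = 1` fixes a non-zero point of `E[p]`: `τ = Φ^j` on `E[p]`
for a Frobenius `Φ` above a good prime `ℓ ∉ S ∪ {p} ∪ {ℓ ∣ Δ_min} ∪ {ℓ ∣ mp}` with
`χ_{mp}(Φ) = 1`, i.e. `ℓ ≡ 1 (mod mp)` (`Rat.modNCyclotomicCharacter_of_isArithFrobAt`), so
`ψ(ℓ) = φ(ℓ) = 1`, `ℓ = 1` in `F`, and the hypothesis reads `a_ℓ ≡ ℓ + 1 (mod p)` (Prop. 2.11 (a),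
`LFunction_apply_prime_eq_frobeniusTrace`), i.e. `p ∣ #Ẽ(𝔽_ℓ)`; then `Φ`, hence `τ`, fixes a
non-zero `P ∈ E[p]` (reduction of torsion, `exists_frobenius_smul_eq_of_dvd_reductionPointCount_holds`).
[cite: DarmonDiamondTaylor1995, Prop. 2.11 (a) p. 57 and Lemma 4.12 p. 120] -/
theorem exists_smul_eq_of_isEisensteinData (W : WeierstrassCurve ℚ) [W.IsElliptic]
    [W.IsGloballyMinimal] (p : ℕ) [Fact p.Prime] (F : Type*) [Field F] [CharP F p]
    (S : Finset ℕ) {m : ℕ} (ψ φ : DirichletCharacter F m)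
    (hE : ∀ ℓ : ℕ, ℓ.Prime → ℓ ∉ S →
      ((W.LFunction ℓ : ℤ) : F) = ψ (ℓ : ZMod m) + (ℓ : F) ^ (2 - 1) * φ (ℓ : ZMod m))
    [NeZero (m * p)] (τ : absoluteGaloisGroup ℚ)
    (hτ : GaloisRepresentations.modNCyclotomicCharacter ℚ (m * p) τ = 1) :
    ∃ P : W.geomTorsion p, P ≠ 0 ∧ τ • P = P := by
  classical
  have hp : p.Prime := Fact.out
  have hΔ0 : minimalDiscriminantInt W ≠ 0 := minimalDiscriminantInt_ne_zero W
  have hmp0 : m * p ≠ 0 := NeZero.ne _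
  -- the excluded primes: `S`, `p`, the divisors of the minimal discriminant and of `m p`
  let S' : Set ℕ := (↑S : Set ℕ) ∪ {ℓ | ℓ = p ∨ (ℓ : ℤ) ∣ minimalDiscriminantInt W ∨ ℓ ∣ m * p}
  have hS' : S'.Finite := by
    refine S.finite_toSet.union ((Set.finite_le_nat
      (max (max p (minimalDiscriminantInt W).natAbs) (m * p))).subset ?_)
    rintro ℓ (rfl | hℓ | hℓ)
    · exact Set.mem_setOf.mpr (le_max_of_le_left (le_max_left _ _))
    · exact Set.mem_setOf.mpr (le_max_of_le_left (le_max_of_le_right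
        (Nat.le_of_dvd (Int.natAbs_pos.mpr hΔ0) (Int.natCast_dvd.mp hℓ))))
    · exact Set.mem_setOf.mpr (le_max_of_le_right (Nat.le_of_dvd (Nat.pos_of_ne_zero hmp0) hℓ))
  obtain ⟨ℓ, v, 𝔓, φ', hℓ, hℓS', hv, h𝔓, hφ', hχ, j, hagree⟩ :=
    exists_frobenius_pow_smul_eq_of_cyclotomic_eq_one W (n := p) (by exact_mod_cast hp.ne_zero)
      (m * p) S' hS' τ hτ
  haveI : Fact ℓ.Prime := ⟨hℓ⟩
  have hℓS : ℓ ∉ S := fun h ↦ hℓS' (Or.inl (Finset.mem_coe.mpr h))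
  have hℓp : ℓ ≠ p := fun h ↦ hℓS' (Or.inr (Or.inl h))
  have hℓΔ : ¬ (ℓ : ℤ) ∣ minimalDiscriminantInt W := fun h ↦ hℓS' (Or.inr (Or.inr (Or.inl h)))
  have hℓmp : ¬ ℓ ∣ m * p := fun h ↦ hℓS' (Or.inr (Or.inr (Or.inr h)))
  have hgood : W.HasGoodReductionAtPrime ℓ := hasGoodReductionAtPrime_of_not_dvd W ℓ hℓΔ
  -- `χ_{mp}(Φ) = ℓ = 1`: `ℓ ≡ 1 (mod m p)`
  have hmod : ℓ ≡ 1 [MOD m * p] := by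
    have h := GaloisRepresentations.Rat.modNCyclotomicCharacter_of_isArithFrobAt
      (N := m * p) hℓ hℓmp hv h𝔓 hφ'
    rw [hχ, Units.val_one] at h
    exact (ZMod.natCast_eq_natCast_iff ℓ 1 (m * p)).mp (by rw [Nat.cast_one]; exact h.symm)
  have hℓm : (ℓ : ZMod m) = 1 := by
    simpa using (ZMod.natCast_eq_natCast_iff ℓ 1 m).mpr (hmod.of_mul_right p)
  have hℓF : (ℓ : F) = 1 := by simpa using CharP.natCast_eq_natCast' F p (hmod.of_mul_left m)
  -- the Eisenstein congruence at `ℓ`: `a_ℓ ≡ ℓ + 1 (mod p)`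
  have hcongr : (p : ℤ) ∣ W.frobeniusTrace ℓ - (ℓ + 1) := by
    rw [← CharP.intCast_eq_zero_iff F p]
    have h := hE ℓ hℓ hℓS
    rw [LFunction_apply_prime_eq_frobeniusTrace W ℓ hgood, hℓm, map_one, map_one, hℓF] at h
    push_cast
    rw [h, hℓF]; norm_num
  have hdvd : p ∣ W.reductionPointCount ℓ := (dvd_frobeniusTrace_sub_iff W p ℓ).mp hcongr
  obtain ⟨P, hP0, hP⟩ := exists_frobenius_smul_eq_of_dvd_reductionPointCount_holds W p ℓ hℓp
    hgood hdvd v hv 𝔓 h𝔓 φ' hφ'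
  refine ⟨P, hP0, ?_⟩  -- `Φ • P = P`, hence `Φ ^ j • P = P`, i.e. `τ • P = P`
  rw [hagree P]
  exact MulAction.mem_stabilizer_iff.mp
    (Subgroup.pow_mem (MulAction.stabilizer (absoluteGaloisGroup ℚ) P)
      (MulAction.mem_stabilizer_iff.mpr hP) j)

/-! ### Steps 2–3 and the discharge -/

/-- **Lemma 4.12 read for `ρ̄_{E,p}`, global minimal model, `p` odd**: Eisenstein data
`a_ℓ(E) = ψ(ℓ) + ℓ φ(ℓ)` (`ℓ ∉ S`) in characteristic `p` contradict the irreducibility of `E[p]`.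
Step 1 (`exists_smul_eq_of_isEisensteinData`) and the relative invariant-line lemma
(`Representation.smul_eq_self_of_normal_of_forall_exists_fixed`, for `ker χ_{mp} ⊴ Γ_ℚ` and the
`𝔽_p`-plane `E[p]`, `#E[p] = p²`) make the image of `Γ_ℚ` abelian; a complex conjugation `c`
(`c² = 1`, `χ̄_p(c) = −1`, Serre 1972 §5.2 (iv)) commutes with it, `ker(c ∓ 1)` are
`Γ_ℚ`-stable and not both `⊥` (`(c − 1)(c + 1) = 0`), so `c = ±1` on `E[p]` and
`χ̄_p(c) = det ρ̄_{E,p}(c) = 1` (Weil pairing, Prop. 2.8 (a)) — contradicting `−1 ≠ 1` in `𝔽_p`,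
`p` odd (p. 87: "if `ℓ` is odd … irreducible if and only if it is absolutely irreducible").
[cite: DarmonDiamondTaylor1995, Prop. 2.6 (b) p. 53, Prop. 2.8 (a) p. 56, p. 87, Lemma 4.12 p. 120] -/
theorem false_of_isEisensteinData_of_hasIrreducibleModPGaloisRep (W : WeierstrassCurve ℚ)
    [W.IsElliptic] [W.IsGloballyMinimal] (p : ℕ) [Fact p.Prime] (hp2 : p ≠ 2)
    (hirr : W.HasIrreducibleModPGaloisRep p) (F : Type*) [Field F] [CharP F p]
    (S : Finset ℕ) {m : ℕ} (hm : 0 < m) (ψ φ : DirichletCharacter F m)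
    (hE : ∀ ℓ : ℕ, ℓ.Prime → ℓ ∉ S →
      ((W.LFunction ℓ : ℤ) : F) = ψ (ℓ : ZMod m) + (ℓ : F) ^ (2 - 1) * φ (ℓ : ZMod m)) :
    False := by
  classical
  have hp : p.Prime := Fact.out
  haveI : NeZero (m * p) := ⟨Nat.mul_ne_zero hm.ne' hp.ne_zero⟩
  haveI : NeZero ((m * p : ℕ) : ℚ) := NeZero.charZero
  haveI : NeZero (p : ℚ) := ⟨Nat.cast_ne_zero.mpr hp.ne_zero⟩
  set χ := GaloisRepresentations.modNCyclotomicCharacter ℚ (m * p) with hχdef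
  let H : Subgroup (absoluteGaloisGroup ℚ) := χ.ker
  have hHn : H.Normal := MonoidHom.normal_ker χ
  -- Step 1: every `τ ∈ H = Γ_{ℚ(ζ_{mp})}` fixes a non-zero point of `E[p]`
  have hfix : ∀ τ ∈ H, ∃ P : W.geomTorsion p, P ≠ 0 ∧ τ • P = P := fun τ hτ ↦
    exists_smul_eq_of_isEisensteinData W p F S ψ φ hE τ (MonoidHom.mem_ker.mp hτ)
  -- Step 2: `H` acts trivially on the irreducible `𝔽_p`-plane `E[p]`
  letI : Module (ZMod p) (W.geomTorsion p) := AddSubgroup.torsionBy.zmodModule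
  have hcard : Nat.card (W.geomTorsion p) = p ^ 2 :=
    card_torsionPoints_eq_sq_holds W (AlgebraicClosure ℚ) (n := p) (by exact_mod_cast hp.ne_zero)
  have h2 : Module.finrank (ZMod p) (W.geomTorsion p) = 2 :=
    Literature.RepresentationTheory.FiniteGroups.Representation.finrank_eq_two_of_natCard_eq_sq hcard
  have htriv : ∀ τ ∈ H, ∀ P : W.geomTorsion p, τ • P = P :=
    Literature.RepresentationTheory.FiniteGroups.Representation.smul_eq_self_of_normal_of_forall_exists_fixed
      h2 H hHn hfix hirr
  -- hence the image of `Γ_ℚ` is abelian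
  have hcomm : ∀ (σ τ : absoluteGaloisGroup ℚ) (P : W.geomTorsion p), σ • τ • P = τ • σ • P := by
    intro σ τ P
    have hmem : (τ * σ)⁻¹ * (σ * τ) ∈ H := by
      rw [MonoidHom.mem_ker, map_mul, map_inv, map_mul, map_mul, mul_comm (χ σ) (χ τ),
        inv_mul_cancel]
    have h := congr_arg (fun Q : W.geomTorsion p ↦ (τ * σ) • Q) (htriv _ hmem P)
    simp only [← mul_smul, mul_inv_cancel_left] at h
    rwa [← mul_smul, ← mul_smul]
  -- Step 3: a complex conjugation `c`, `c² = 1`, `χ̄_p(c) = -1`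
  obtain ⟨c, hc2, hχc⟩ := exists_sq_eq_one_modPCyclotomicCharacterZMod_eq_neg_one p
  have hcc : ∀ P : W.geomTorsion p, c • c • P = P := fun P ↦ by
    rw [← mul_smul, ← pow_two, hc2, one_smul]
  -- the `Γ_ℚ`-stable subgroups `ker (c - 1)` and `ker (c + 1)`
  let fc : W.geomTorsion p →+ W.geomTorsion p := DistribSMul.toAddMonoidHom (W.geomTorsion p) c
  have hfc : ∀ P : W.geomTorsion p, fc P = c • P := fun _ ↦ rfl
  let Bp : AddSubgroup (W.geomTorsion p) := (fc - AddMonoidHom.id (W.geomTorsion p)).ker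
  let Bm : AddSubgroup (W.geomTorsion p) := (fc + AddMonoidHom.id (W.geomTorsion p)).ker
  have hBp : ∀ P, P ∈ Bp ↔ c • P = P := fun P ↦ by
    change P ∈ (fc - AddMonoidHom.id (W.geomTorsion p)).ker ↔ _
    rw [AddMonoidHom.mem_ker, AddMonoidHom.sub_apply, AddMonoidHom.id_apply, hfc, sub_eq_zero]
  have hBm : ∀ P, P ∈ Bm ↔ c • P = -P := fun P ↦ by
    change P ∈ (fc + AddMonoidHom.id (W.geomTorsion p)).ker ↔ _
    rw [AddMonoidHom.mem_ker, AddMonoidHom.add_apply, AddMonoidHom.id_apply, hfc,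
      add_eq_zero_iff_eq_neg]
  have hBpst : ∀ σ : absoluteGaloisGroup ℚ, ∀ P ∈ Bp, σ • P ∈ Bp := fun σ P hP ↦ by
    rw [hBp] at hP ⊢; rw [hcomm, hP]
  have hBmst : ∀ σ : absoluteGaloisGroup ℚ, ∀ P ∈ Bm, σ • P ∈ Bm := fun σ P hP ↦ by
    rw [hBm] at hP ⊢; rw [hcomm, hP, smul_neg]
  -- a basis `P₀, P₁` of `E[p]` to read off determinants
  haveI : Nontrivial (W.geomTorsion p) := Module.nontrivial_of_finrank_pos (R := ZMod p) (by omega)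
  obtain ⟨P₀, hP₀⟩ := exists_ne (0 : W.geomTorsion p)
  obtain ⟨P₁, hP₁⟩ : ∃ P₁ : W.geomTorsion p, P₁ ∉ AddSubgroup.zmultiples P₀ := by
    by_contra hall
    push Not at hall
    have htop : AddSubgroup.zmultiples P₀ = ⊤ := (AddSubgroup.eq_top_iff' _).mpr hall
    have hc1 : Nat.card (AddSubgroup.zmultiples P₀) = p := by
      rw [Nat.card_zmultiples, addOrderOf_eq_prime (AddSubgroup.torsionBy.nsmul P₀) hP₀]
    rw [htop, AddSubgroup.card_top, hcard, sq, Nat.mul_eq_right hp.ne_zero] at hc1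
    exact hp.one_lt.ne' hc1
  -- `(c - 1)(c + 1) = 0`: the two kernels are not both `⊥`
  have hne : ¬ (Bp = ⊥ ∧ Bm = ⊥) := by
    rintro ⟨hp0, hm0⟩
    apply hP₀
    have h1 : c • P₀ + P₀ ∈ Bp := by rw [hBp, smul_add, hcc, add_comm]
    rw [hp0, AddSubgroup.mem_bot] at h1
    have h2' : P₀ ∈ Bm := by rw [hBm]; exact eq_neg_of_add_eq_zero_left h1
    rwa [hm0, AddSubgroup.mem_bot] at h2'
  -- in either case `c = ±1` on `E[p]`, so `χ̄_p(c) = det = 1`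
  have hdet : ((GaloisRepresentations.modPCyclotomicCharacterZMod ℚ p c : (ZMod p)ˣ) : ZMod p)
      = 1 := by
    rcases hirr Bp hBpst with hB | hB
    · rcases hirr Bm hBmst with hB' | hB'
      · exact absurd ⟨hB, hB'⟩ hne
      · have hcP : ∀ P : W.geomTorsion p, c • P = -P := fun P ↦
          (hBm P).mp (hB' ▸ AddSubgroup.mem_top P)
        have h₀ : c • P₀ = (-1 : ℤ) • P₀ + (0 : ℤ) • P₁ := by
          rw [hcP, neg_one_zsmul, zero_zsmul, add_zero]
        have h₁ : c • P₁ = (0 : ℤ) • P₀ + (-1 : ℤ) • P₁ := by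
          rw [hcP, zero_zsmul, neg_one_zsmul, zero_add]
        have h := MatarNekovar2019.modPCyclotomicCharacter_eq_det_of_basis W p hP₀ hP₁ h₀ h₁
        rw [h]
        push_cast
        ring
    · have hcP : ∀ P : W.geomTorsion p, c • P = P := fun P ↦
        (hBp P).mp (hB ▸ AddSubgroup.mem_top P)
      have h₀ : c • P₀ = (1 : ℤ) • P₀ + (0 : ℤ) • P₁ := by
        rw [hcP, one_zsmul, zero_zsmul, add_zero]
      have h₁ : c • P₁ = (0 : ℤ) • P₀ + (1 : ℤ) • P₁ := by
        rw [hcP, zero_zsmul, one_zsmul, zero_add]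
      have h := MatarNekovar2019.modPCyclotomicCharacter_eq_det_of_basis W p hP₀ hP₁ h₀ h₁
      rw [h]
      push_cast
      ring
  -- contradiction: `-1 ≠ 1` in `𝔽_p` for `p` odd
  rw [hdet] at hχc
  haveI : Fact (2 < p) := ⟨lt_of_le_of_ne hp.two_le (Ne.symm hp2)⟩
  exact ZMod.neg_one_ne_one hχc.symm

/-- **Discharge of the named fact
`Literature.NumberTheory.EllipticCurves.not_isEisensteinEigensystem_of_hasIrreducibleModPGaloisRep`**
(Darmon–Diamond–Taylor 1995, Prop. 2.6 (b), 2.8 (a), 2.11 (a), p. 87, Lemma 4.12 — the reading of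
the fact file's module docstring, Chebotarev replaced by Frobenius' density theorem and
Brauer–Nesbitt by the invariant-line lemmas, all proved in the tree). For an arbitrary model `W`:
pass to a global minimal model `C • W` (`hasGlobalMinimalModel_rat_holds`; same `L`-function,
`LFunction_smul`; same irreducibility, `hasIrreducibleModPGaloisRep_smul_iff`) and apply
`false_of_isEisensteinData_of_hasIrreducibleModPGaloisRep`.
[cite: DarmonDiamondTaylor1995, Prop. 2.6 (b) p. 53, Prop. 2.8 (a) p. 56, Prop. 2.11 (a) p. 57, p. 87, Lemma 4.12 p. 120] -/
theorem not_isEisensteinEigensystem_of_hasIrreducibleModPGaloisRep_holds :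
    not_isEisensteinEigensystem_of_hasIrreducibleModPGaloisRep := by
  intro W _ p _ hp2 hirr F _ _ hEis
  obtain ⟨S, m, ψ, φ, hm, hE⟩ := hEis
  obtain ⟨C, hC⟩ := hasGlobalMinimalModel_rat_holds W
  haveI := hC
  have hirr' : (C • W).HasIrreducibleModPGaloisRep p :=
    (Mazur1978.hasIrreducibleModPGaloisRep_smul_iff W C p).mpr hirr
  refine false_of_isEisensteinData_of_hasIrreducibleModPGaloisRep (C • W) p hp2 hirr' F S hm ψ φ
    fun ℓ hℓ hℓS ↦ ?_
  rw [LFunction_smul W C]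
  exact hE ℓ hℓ hℓS

end Literature.NumberTheory.EllipticCurves

end
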